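import Literature.NumberTheory.Rogawski1990.LocalTransferTransport
import HarnessLib

/-!
# The transported orbital measure family `ψ_* m′` keeps the three admissibility properties: non-zero, finite on compact sets,
# INVARIANT (Rogawski (1990), §14.2: the «compatible measures» of (14.2.1); Gelbart (1975), §10 pp. 154–155)

Topic `NumberTheory/Rogawski1990`; namespace `Literature.NumberTheory.Rogawski1990` (sequel of ★ `LocalTransferTransport`, (L6b)).
THEOREMS ONLY: no definition, no named fact, no `sorry`, no instance.

For a bicontinuous `ψ : B ≃* A` and a family `m′` of orbital measures on `B`, the class-`c` component of ★ `OrbitalMeasureFamily.transport`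
is `(x_c⁻¹ • ·)_* (cosetCongr e_c)_* m′(ψ⁻¹ c)` (`transport_apply`); hence (★ `isFiniteMeasureOnCompacts_map_cosetCongr`,
★ `smulInvariantMeasure_map_cosetCongr_of_smulInvariantMeasure`, Mathlib `IsFiniteMeasureOnCompacts.map`, `MeasureTheory.map_smul`):
`transport_ne_zero`, `isFiniteMeasureOnCompacts_transport`, `smulInvariantMeasure_transport` — the transported family is ADMISSIBLE on every
class on which `m′` is (the hypotheses of the ENGINE T1 kit's pin «`IsAdmissibleOn`», ed. 1.15–1.16, transfer along `ψ_v`).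
HC_CM is proved only modulo the printed citations until rung 0 closes; this file is unconditional.

## References
* [Rogawski1990] J. Rogawski, Ann. of Math. Stud. 123 (1990), §14.2 (14.2.1) p. 232.
* [Gelbart1975] S. Gelbart, Ann. of Math. Stud. 83 (1975), §10 pp. 154–155.
-/

set_option autoImplicit false

noncomputable section

open MeasureTheory NumberField IsDedekindDomain Topology
open scoped Pointwise

namespace Literature.NumberTheory.Rogawski1990

open Literature.MeasureTheory.Group Literature.NumberTheory.Automorphic

section Transport

variable {A B : Type*} [Group A] [Group B] (ψ : B ≃* A) [TopologicalSpace A] [TopologicalSpace B] [IsTopologicalGroup A]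
  (hψ : Continuous ψ) (hψs : Continuous ψ.symm)
  [∀ a : A, MeasurableSpace (A ⧸ Subgroup.centralizer ({a} : Set A))] [∀ a : A, BorelSpace (A ⧸ Subgroup.centralizer ({a} : Set A))]
  [∀ b : B, MeasurableSpace (B ⧸ Subgroup.centralizer ({b} : Set B))] [∀ b : B, BorelSpace (B ⧸ Subgroup.centralizer ({b} : Set B))]
  (m' : OrbitalMeasureFamily B) (c : ConjClasses A)

/-- **The class-`c` component of `ψ_* m′`** is the push-forward of `m′(ψ⁻¹ c)` along ★ `cosetCongr e_c` followed by the left translation by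
`x_c⁻¹`. [cite: Gelbart1975, §10 pp. 154–155] -/
theorem transport_apply :
    m'.transport ψ hψ hψs c =
      Measure.map (fun z : A ⧸ Subgroup.centralizer ({(Quotient.out c : A)} : Set A) => (transportConj ψ c)⁻¹ • z)
        (Measure.map (cosetCongr (transportEquiv ψ c) _ _
          (forall_apply_mem_centralizer_singleton_iff_of_eq (transportEquiv ψ c) (transportEquiv_out ψ c)))
          (m' (preClass ψ c))) := by
  rw [OrbitalMeasureFamily.transport, Measure.map_map (measurable_const_smul _)
    (measurable_cosetCongr (transportEquiv ψ c) _ _ _ (continuous_transportEquiv ψ hψ c))]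
  rfl

/-- **`ψ_* m′` is non-zero on `c` if `m′` is non-zero on `ψ⁻¹ c`.** [cite: Gelbart1975, §10 pp. 154–155] -/
theorem transport_ne_zero (h : m' (preClass ψ c) ≠ 0) : m'.transport ψ hψ hψs c ≠ 0 := by
  rw [OrbitalMeasureFamily.transport, Ne, Measure.map_eq_zero_iff (transportOrbitEquiv ψ hψ hψs c).measurable.aemeasurable]
  exact h

/-- **`ψ_* m′` is finite on compact sets on `c` if `m′` is on `ψ⁻¹ c`.** [cite: Gelbart1975, §10 pp. 154–155] -/
theorem isFiniteMeasureOnCompacts_transport [IsFiniteMeasureOnCompacts (m' (preClass ψ c))] :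
    IsFiniteMeasureOnCompacts (m'.transport ψ hψ hψs c) := by
  rw [transport_apply]
  haveI := isFiniteMeasureOnCompacts_map_cosetCongr (transportEquiv ψ c) _ _
    (forall_apply_mem_centralizer_singleton_iff_of_eq (transportEquiv ψ c) (transportEquiv_out ψ c))
    (continuous_transportEquiv ψ hψ c) (continuous_transportEquiv_symm ψ hψs c) (m' (preClass ψ c))
  exact Measure.IsFiniteMeasureOnCompacts.map _ (Homeomorph.smul ((transportConj ψ c)⁻¹ : A))

/-- **`ψ_* m′` is `A`-INVARIANT on `c` if `m′` is `B`-invariant on `ψ⁻¹ c`** (the push-forward along `cosetCongr e_c` is invariant, ★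
`smulInvariantMeasure_map_cosetCongr_of_smulInvariantMeasure`, and the left translation by `x_c⁻¹` does not change an invariant measure,
Mathlib `MeasureTheory.map_smul`). [cite: Gelbart1975, §10 pp. 154–155] -/
theorem smulInvariantMeasure_transport
    [SMulInvariantMeasure B (B ⧸ Subgroup.centralizer ({(Quotient.out (preClass ψ c) : B)} : Set B)) (m' (preClass ψ c))] :
    SMulInvariantMeasure A (A ⧸ Subgroup.centralizer ({(Quotient.out c : A)} : Set A)) (m'.transport ψ hψ hψs c) := by
  rw [transport_apply]
  haveI := smulInvariantMeasure_map_cosetCongr_of_smulInvariantMeasure (transportEquiv ψ c) _ _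
    (forall_apply_mem_centralizer_singleton_iff_of_eq (transportEquiv ψ c) (transportEquiv_out ψ c))
    (continuous_transportEquiv ψ hψ c) (m' (preClass ψ c))
  rw [MeasureTheory.map_smul]
  infer_instance

end Transport

end Literature.NumberTheory.Rogawski1990

end
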